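import Summits.CriticalPhenomena.PercolationContinuityZ3.Theorems.PercNearOneGluingNoHeavyLowerTailCertRowsLinear
import Summits.CriticalPhenomena.PercolationContinuityZ3.Theorems.PercNearOneGluingNoHeavyLowerTailPsiZeroB
import Summits.CriticalPhenomena.PercolationContinuityZ3.Theorems.PercNearOneGluingNoHeavyLowerTailQ7Three
import HarnessLib

/-!
# `NoHeavyLowerTail` (stmt-CriticalPhenomena-4575) — LEMMA T(i) = `Ψ(0) ≥ 0` under `μ(j↔b) ≤ μ(p↔b) ≤ μ(q↔b)`:
# the last open atom (regime A′) of the formal face of the `2 + m` Kozma–Nitzan kernel, for EVERY finite weighted graph,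
# from a two-level degree-2 law-level certificate

Support file (certificate seat `prim-cert-1`, gen 5; `--supports stmt-CriticalPhenomena-4575`).  No named facts, no sorries,
standard axioms.  (The crux is closed; this is a helper theorem of the structural Question-9 line: prim-lf-3 LF3-BETA-R.md §16
reduces the formal face of the `2 + m` kernel to `T(i)` — "KN (9) with a spectator", `w = j` — plus an anchoring step.)

SETTING.  Five terminals placed injectively by `v : Fin 5 → Fin n`: `0 = b`, `1 = z`, `2 = j`, `3 = p`, `4 = q` (`A = {p,q}`).
  `Ψ := μ(z↔b) + μ({p↔b ∨ q↔b} ∧ {z ↮ b,p,q,j}) − μ(j↔b) − μ({z↔b} ∧ {p↮b} ∧ {q↮b} ∧ {j↔p ∨ j↔q})`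
(= prim-lf-3's `D − a_j + a_z`, `D = μ_M(Xb,¬zb,j≁z) − μ_M(zb,¬Xb,j∼X)`, `M = G/{p,q}`; = lead's `Ψ_Y(0)`, LEAD-GEN11 §3h; cp-gz PHI-PSI-CERT STEP 0
checked the cell-by-cell agreement).  THEOREM (`lemmaT`): `Ψ ≥ 0` whenever `μ(j↔b) ≤ μ(p↔b)` and `μ(j↔b) ≤ μ(q↔b)`.
Numerically this was known (0 violations; lf-3 §16b, this seat's census); every LINEAR certificate over KN Lemma-3/5/(E)/q7 rows
fails (lf-3 §16d/16k) and so does every degree-2 certificate over Harris / single-vertex two-cluster rows (this seat, kit j085711–j086095;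
cp-gz D = 2 over its 714k-row cone).  What works: van den Berg–Häggström–Kahn two-SET conditional association with the SET splits
`{z,j} ↮ {p,q}` (found by column generation over all 180 set splits, kit j087978).

LEVEL 1 (kit j087978, exact, denominator 14):
  `M₀·Ψ = R₁ + R₂ + Σ x_c·(KN/BHK linear rows) + slack`,  `M₀ = Σ_{9 cells} w_c x_c`,
  `R₁ = twoSetRow {z,j} {p,q}`: given `D = {z,j}↮{p,q}`, `μ(D, b↔{z,j}, z↮j)·μ(D) ≤ μ(D, b↔{z,j})·μ(D, z↮j)`;
  `R₂ = twoSetRow {p,q} {z,j}`: `μ(D, z↮j, b↮p, b↮q)·μ(D) ≤ μ(D, z↮j)·μ(D, b↮p, b↮q)`;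
  linear rows: the hypothesis `μ(jb) ≤ μ(pb)` (×4 cells), Kozma–Nitzan Question 7 at three relays `μ(jb, z↔{j,p,q}) ≤ μ(zb, z↔{j,p,q})`
  (`Q7Psi.q7_three`, ×5 cells), two TRANSPORT rows and two MIXED Lemma-3 rows for the pair `p ≤ q` (`…CertRowsLinear`).
LEVEL 2 (kit j088472, denominator 6): on the face `M₀ = 0` (its 9 cells vanish, in particular `x[bj|z|p|q] = x[bj|z|pq] = 0`),
  `M₀′·Ψ = Σ x_c·(Q7 row) + Σ x_d·(0 − x[bj|z|p|q]) + Σ x_d·(0 − x[bj|z|pq]) + slack`, `M₀′ = Σ_{9 cells} x_c / 6`, and the union of the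
  two multiplier supports contains EVERY cell on which `Ψ` has a negative coefficient — so on `M₀ = M₀′ = 0` the functional is a sum of
  nonnegative cells.  Hence `Ψ ≥ 0` with no positivity proviso (`psiVal_nonneg`).
Both identities are checked by the kernel (`CertCheck.checkQ`, `decide`); the rows are discharged by `twoSetRow_holds`, `transportLinRow_holds`,
`mixedLinRow_holds` (tree) and `Q7Psi.q7_three` (tree, CSH-free).  The `p ↔ q` symmetric statement `lemmaT` follows by relabelling.
[cite: VandenbergHaggstromKahn2005, Thm. 1.5 (p. 7), Thm. 2.1 (p. 9)] [cite: KozmaNitzan2024, Lemma 3 (pp. 6–7), Question 7 (p. 36)]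
-/

noncomputable section

namespace Summit.CriticalPhenomena.PercolationContinuityZ3.Theorems

open MeasureTheory Set Literature.Probability.Percolation
open Literature.Probability.LatticeModels (prodBernoulli)
open scoped Classical BigOperators
open PatternCells CertCheck CertCells

namespace LemmaTPsi

open PsiZeroB (fZB fJB fABEZ fLAST psiVal tpos tneg psiVal_eq set_fJB set_fZB)

variable {n : ℕ}

/-! ## Events (terminals `0=b,1=z,2=j,3=p,4=q`; `fZB, fJB, fABEZ, fLAST, psiVal` from `…PsiZeroB`) -/

/-- `{p ↔ b}`. [folklore] -/
def fPB : Formula := [[(3, 0, true)]]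
/-- `{j↔b} ∧ ({z↔p} ∨ {z↔q} ∨ {z↔j})` (smaller side of the Question-7 row). [folklore] -/
def fQ7lo : Formula := [[(2, 0, true), (1, 3, true)], [(2, 0, true), (1, 4, true)], [(2, 0, true), (1, 2, true)]]
/-- `{z↔b} ∧ ({z↔p} ∨ {z↔q} ∨ {z↔j})` (larger side of the Question-7 row). [folklore] -/
def fQ7hi : Formula := [[(1, 0, true), (1, 3, true)], [(1, 0, true), (1, 4, true)], [(1, 0, true), (1, 2, true)]]

/-- The signed quadratic terms of `(Σ_{(c,w) ∈ M} w·x_c) · Ψ`. [this file] -/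
def tsOf (M : List (ℕ × ℕ)) : List QTerm :=
  M.flatMap fun p => [⟨[p.1], cellsOf fZB, p.2, true⟩, ⟨[p.1], cellsOf fABEZ, p.2, true⟩,
    ⟨[p.1], cellsOf fJB, p.2, false⟩, ⟨[p.1], cellsOf fLAST, p.2, false⟩]

/-- Value of a cell-weight list. [this file] -/
def mval (x : ℕ → ℝ) (M : List (ℕ × ℕ)) : ℝ := (M.map fun p => (p.2 : ℝ) * x p.1).sum

/-- The checker terms of `M` evaluate to `M(x) · Ψ(x)`. [this file] -/
theorem qval_tsOf (x : ℕ → ℝ) (M : List (ℕ × ℕ)) : qval x (tsOf M) = mval x M * psiVal x := by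
  induction M with
  | nil => simp [qval, tsOf, mval]
  | cons p M ih =>
    have hq : qval x (tsOf (p :: M)) = ((p.2 : ℝ) * (x p.1 * linEval x (cellsOf fZB)) + (p.2 : ℝ) * (x p.1 * linEval x (cellsOf fABEZ))
        - (p.2 : ℝ) * (x p.1 * linEval x (cellsOf fJB)) - (p.2 : ℝ) * (x p.1 * linEval x (cellsOf fLAST))) + qval x (tsOf M) := by
      simp only [qval, tsOf, List.flatMap_cons, List.map_append, List.sum_append, List.map_cons, List.map_nil, List.sum_cons,
        List.sum_nil, QTerm.val, linEval_single, Bool.false_eq_true, ite_true, ite_false]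
      ring
    rw [hq, ih]
    simp only [mval, List.map_cons, List.sum_cons, psiVal]
    ring

/-- `M(x) ≥ 0` at `x ≥ 0`. [folklore] -/
theorem mval_nonneg (x : ℕ → ℝ) (hx : ∀ i, 0 ≤ x i) (M : List (ℕ × ℕ)) : 0 ≤ mval x M :=
  List.sum_nonneg fun y hy => by
    obtain ⟨q, _, rfl⟩ := List.mem_map.1 hy
    exact mul_nonneg (Nat.cast_nonneg _) (hx _)

/-- On `M(x) = 0` (with `x ≥ 0`) every cell of `M` with positive weight vanishes. [folklore] -/
theorem cells_zero_of_mval_zero (x : ℕ → ℝ) (hx : ∀ i, 0 ≤ x i) (M : List (ℕ × ℕ)) (h0 : mval x M = 0) :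
    ∀ p ∈ M, 0 < p.2 → x p.1 = 0 := by
  intro p hp hw
  have hnn : ∀ q ∈ M, 0 ≤ (q.2 : ℝ) * x q.1 := fun q _ => mul_nonneg (Nat.cast_nonneg _) (hx _)
  have hle : (p.2 : ℝ) * x p.1 ≤ mval x M :=
    List.single_le_sum (fun y hy => by
      obtain ⟨q, hq, rfl⟩ := List.mem_map.1 hy
      exact hnn q hq) _ (List.mem_map.2 ⟨p, hp, rfl⟩)
  rw [h0] at hle
  have hzero : (p.2 : ℝ) * x p.1 = 0 := le_antisymm hle (hnn p hp)
  rcases mul_eq_zero.1 hzero with h | h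
  · exact absurd h (by exact_mod_cast hw.ne')
  · exact h

/-- From `0 ≤ M·Ψ`: either `Ψ ≥ 0` or all cells of `M` vanish. [folklore] -/
theorem nonneg_or_face (x : ℕ → ℝ) (hx : ∀ i, 0 ≤ x i) (M : List (ℕ × ℕ)) (h : 0 ≤ mval x M * psiVal x) :
    0 ≤ psiVal x ∨ ∀ p ∈ M, 0 < p.2 → x p.1 = 0 := by
  rcases (mval_nonneg x hx M).lt_or_eq with hpos | hzero
  · left
    by_contra hneg
    push Not at hneg
    have : mval x M * psiVal x < 0 := mul_neg_of_pos_of_neg hpos hneg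
    linarith
  · exact Or.inr (cells_zero_of_mval_zero x hx M hzero.symm)

/-! ## Level 1: the certificate on the whole simplex -/

/-- Multiplier cells and weights (×14) of level 1. [this file] -/
def m1 : List (ℕ × ℕ) := [(0, 1), (2, 2), (16, 1), (19, 2), (24, 2), (512, 1), (514, 2), (528, 1), (531, 2)]

/-- Row `R₁`: two-set conditional association on `{z,j} ↮ {p,q}` with `A = {b↔z ∨ b↔j}`, `B = {z↮j}`. [this file] -/
def row1 : Row := twoSetRow [1, 2] [3, 4] [[(0, 1, true)], [(0, 2, true)]] [[]] [[(1, 2, false)]] [[]] [] 1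

/-- Row `R₂`: two-set conditional association on `{p,q} ↮ {z,j}` with `A = {z↮j}`, `B = {b↮p ∧ b↮q}`. [this file] -/
def row2 : Row := twoSetRow [3, 4] [1, 2] [[(1, 2, false)]] [[]] [[(0, 3, false), (0, 4, false)]] [[]] [] 1

/-- The linear rows of level 1: hypothesis `μ(jb) ≤ μ(pb)`, Question 7, transport and mixed Lemma-3 rows for `p ≤ q`. [this file] -/
def lrows1 : List LinRow :=
  [⟨cellsOf fJB, cellsOf fPB, [0], 1⟩,
   ⟨cellsOf fJB, cellsOf fPB, [2], 2⟩,
   ⟨cellsOf fJB, cellsOf fPB, [512], 1⟩,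
   ⟨cellsOf fJB, cellsOf fPB, [514], 2⟩,
   ⟨cellsOf fQ7lo, cellsOf fQ7hi, [528], 1⟩,
   ⟨cellsOf fQ7lo, cellsOf fQ7hi, [531], 2⟩,
   ⟨cellsOf fQ7lo, cellsOf fQ7hi, [16], 1⟩,
   ⟨cellsOf fQ7lo, cellsOf fQ7hi, [19], 2⟩,
   transportLinRow 3 4 0 [1] [[(1, 4, true)], [(4, 3, true)]] [512] 1,
   transportLinRow 3 4 0 [1] [[(1, 4, true)]] [514] 2,
   ⟨cellsOf fQ7lo, cellsOf fQ7hi, [24], 2⟩,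
   mixedLinRow 3 4 0 [[(4, 1, true)], [(4, 3, true)]] [0] 1,
   mixedLinRow 3 4 0 [[(4, 1, true)]] [2] 2]

/-- **Kernel check of level 1.** [this file] -/
theorem check1 : checkQ [([], 1)] (tsOf m1) [row1, row2] lrows1 = true := by
  decide +kernel

/-! ## Level 2: the certificate on the face `M₀ = 0` -/

/-- Multiplier cells and weights (×6) of level 2. [this file] -/
def m2 : List (ℕ × ℕ) := [(1, 1), (4, 1), (34, 1), (66, 1), (198, 1), (260, 1), (298, 1), (513, 1), (610, 1)]

/-- The linear rows of level 2: the face rows `x[2] ≤ 0`, `x[514] ≤ 0` (valid on the face) and Question 7. [this file] -/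
def lrows2 : List LinRow :=
  [⟨[2], [], [1], 1⟩,
   ⟨[2], [], [4], 1⟩,
   ⟨[2], [], [34], 1⟩,
   ⟨[2], [], [66], 1⟩,
   ⟨[2], [], [198], 1⟩,
   ⟨[2], [], [260], 1⟩,
   ⟨[2], [], [298], 1⟩,
   ⟨[2], [], [513], 1⟩,
   ⟨[2], [], [610], 1⟩,
   ⟨[514], [], [1], 1⟩,
   ⟨[514], [], [4], 1⟩,
   ⟨[514], [], [34], 1⟩,
   ⟨[514], [], [66], 1⟩,
   ⟨[514], [], [198], 1⟩,
   ⟨[514], [], [260], 1⟩,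
   ⟨[514], [], [298], 1⟩,
   ⟨[514], [], [513], 1⟩,
   ⟨[514], [], [610], 1⟩,
   ⟨cellsOf fQ7lo, cellsOf fQ7hi, [198], 1⟩,
   ⟨cellsOf fQ7lo, cellsOf fQ7hi, [298], 1⟩,
   ⟨cellsOf fQ7lo, cellsOf fQ7hi, [610], 1⟩,
   ⟨cellsOf fQ7lo, cellsOf fQ7hi, [66], 1⟩,
   ⟨cellsOf fQ7lo, cellsOf fQ7hi, [34], 1⟩]

/-- **Kernel check of level 2.** [this file] -/
theorem check2 : checkQ [([], 1)] (tsOf m2) [] lrows2 = true := by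
  decide +kernel

/-! ## The negative cells of `Ψ` (`PsiZeroB.tneg`) are covered by the two multiplier supports -/

/-- Every negative cell of `Ψ` is a positive-weight cell of `m1` or of `m2`. [this file] -/
theorem tneg_covered : ∀ c ∈ tneg, (∃ p ∈ m1, p.1 = c ∧ 0 < p.2) ∨ (∃ p ∈ m2, p.1 = c ∧ 0 < p.2) := by decide +kernel

/-- The two face cells used by level 2 are positive-weight cells of `m1`. [this file] -/
theorem face_cells : (∃ p ∈ m1, p.1 = 2 ∧ 0 < p.2) ∧ (∃ p ∈ m1, p.1 = 514 ∧ 0 < p.2) := by decide +kernel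

/-! ## `Ψ ≥ 0` at the cell level -/

/-- **`Ψ(x) ≥ 0`** for every `x ≥ 0` at which the two product rows, the hypothesis row, the Question-7 row and the four
transport / mixed rows hold — no positivity proviso (two-level face argument). [this file] -/
theorem psiVal_nonneg (x : ℕ → ℝ) (hx : ∀ i, 0 ≤ x i)
    (h1 : linEval x row1.e1 * linEval x row1.e2 ≤ linEval x row1.e3 * linEval x row1.e4)
    (h2 : linEval x row2.e1 * linEval x row2.e2 ≤ linEval x row2.e3 * linEval x row2.e4)
    (hl1 : ∀ r ∈ lrows1, linEval x r.eLo ≤ linEval x r.eHi)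
    (hQ7 : linEval x (cellsOf fQ7lo) ≤ linEval x (cellsOf fQ7hi)) : 0 ≤ psiVal x := by
  -- level 1
  have hrows := rowSumLE_of_forall x hx [row1, row2] (by
    intro r hr
    simp only [List.mem_cons, List.mem_nil_iff, or_false] at hr
    rcases hr with rfl | rfl
    · exact h1
    · exact h2)
  have key1 := soundQ x hx [([], 1)] (tsOf m1) [row1, row2] lrows1 hrows hl1 check1
  have hm : m0val x [([], 1)] = 1 := by simp [m0val, evalM]
  rw [hm, one_mul, qval_tsOf] at key1
  rcases nonneg_or_face x hx m1 key1 with hpos | hface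
  · exact hpos
  -- level 2, on the face `m1 = 0`
  have hx2 : x 2 = 0 := by obtain ⟨p, hp, hpc, hw⟩ := face_cells.1; rw [← hpc]; exact hface p hp hw
  have hx514 : x 514 = 0 := by obtain ⟨p, hp, hpc, hw⟩ := face_cells.2; rw [← hpc]; exact hface p hp hw
  have hl2 : ∀ r ∈ lrows2, linEval x r.eLo ≤ linEval x r.eHi := by
    intro r hr
    simp only [lrows2, List.mem_cons, List.mem_nil_iff, or_false] at hr
    rcases hr with rfl | rfl | rfl | rfl | rfl | rfl | rfl | rfl | rfl | rfl | rfl | rfl | rfl | rfl | rfl | rfl | rfl | rfl |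
        rfl | rfl | rfl | rfl | rfl <;>
      first
        | exact hQ7
        | (simp only [linEval, List.map_cons, List.map_nil, List.sum_cons, List.sum_nil, add_zero]; linarith)
  have hrows2 := rowSumLE_of_forall x hx ([] : List Row) (by intro r hr; simp at hr)
  have key2 := soundQ x hx [([], 1)] (tsOf m2) [] lrows2 hrows2 hl2 check2
  rw [hm, one_mul, qval_tsOf] at key2
  rcases nonneg_or_face x hx m2 key2 with hpos | hface2
  · exact hpos
  -- both multiplier supports vanish: every negative cell of Ψ is zero
  have hneg0 : linEval x tneg = 0 := by
    unfold linEval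
    apply List.sum_eq_zero
    intro y hy
    obtain ⟨c, hcm, rfl⟩ := List.mem_map.1 hy
    rcases tneg_covered c hcm with ⟨p, hp, hpc, hw⟩ | ⟨p, hp, hpc, hw⟩
    · rw [← hpc]; exact hface p hp hw
    · rw [← hpc]; exact hface2 p hp hw
  have hpos0 : 0 ≤ linEval x tpos := by
    unfold linEval
    exact List.sum_nonneg fun y hy => by
      obtain ⟨c, _, rfl⟩ := List.mem_map.1 hy
      exact hx c
  rw [psiVal_eq, hneg0, sub_zero]
  exact hpos0

/-! ## Measure level -/

/-- `{p ↔ b}`. [folklore] -/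
theorem set_fPB (v : Fin 5 → Fin n) : fPB.set v = (openConn (v 3) (v 0) : Set (BondConfig (Fin n))) := by
  ext ω
  simp only [fPB, mem_set_cons, not_mem_set_nil, List.forall_mem_cons, forall_mem_nil_iff, holds_true, and_true, or_false]

/-- The Question-7 events: `{t↔b} ∧ ({z↔p} ∨ {z↔q} ∨ {z↔j})`. [folklore] -/
theorem set_fQ7 (v : Fin 5 → Fin n) (t : Fin 5) :
    Formula.set v [[(t, 0, true), (1, 3, true)], [(t, 0, true), (1, 4, true)], [(t, 0, true), (1, 2, true)]] =
      (openConn (v t) (v 0) : Set (BondConfig (Fin n))) ∩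
        (openConn (v 1) (v 3) ∪ openConn (v 1) (v 4) ∪ openConn (v 1) (v 2)) := by
  ext ω
  simp only [mem_set_cons, not_mem_set_nil, List.forall_mem_cons, forall_mem_nil_iff, holds_true, and_true, or_false,
    Set.mem_inter_iff, Set.mem_union]
  tauto

/-- **LEMMA T(i), ordered ports.**  For every weight vector `w`, every injective placement `v` of `(b,z,j,p,q) = (v 0,…,v 4)` with
`μ(j↔b) ≤ μ(p↔b) ≤ μ(q↔b)`:
  `μ(j↔b) + μ({z↔b} ∧ {p↮b} ∧ {q↮b} ∧ ({j↔p} ∨ {j↔q})) ≤ μ(z↔b) + μ(({p↔b} ∨ {q↔b}) ∧ {z ↮ b,p,q,j})`.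
[cite: VandenbergHaggstromKahn2005, Thm. 1.5 (p. 7)] [cite: KozmaNitzan2024, Question 7 (p. 36)] -/
theorem lemmaT_ordered (w : Sym2 (Fin n) → unitInterval) (v : Fin 5 → Fin n) (hv : Function.Injective v)
    (hjp : (prodBernoulli w).real (openConn (v 2) (v 0)) ≤ (prodBernoulli w).real (openConn (v 3) (v 0)))
    (hpq : (prodBernoulli w).real (openConn (v 3) (v 0)) ≤ (prodBernoulli w).real (openConn (v 4) (v 0))) :
    (prodBernoulli w).real (fJB.set v) + (prodBernoulli w).real (fLAST.set v) ≤
      (prodBernoulli w).real (fZB.set v) + (prodBernoulli w).real (fABEZ.set v) := by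
  set x : ℕ → ℝ := fun m => (prodBernoulli w).real (Cell v m) with hxdef
  have hx : ∀ i, 0 ≤ x i := fun i => measureReal_nonneg
  have h1 := twoSetRow_holds w v [1, 2] [3, 4] [[(0, 1, true)], [(0, 2, true)]] [[]] [[(1, 2, false)]] [[]]
    (by decide) (by decide) (by decide) (by decide) [] 1
  have h2 := twoSetRow_holds w v [3, 4] [1, 2] [[(1, 2, false)]] [[]] [[(0, 3, false), (0, 4, false)]] [[]]
    (by decide) (by decide) (by decide) (by decide) [] 1
  have hJP : ∀ (mult : List ℕ) (wt : ℕ), linEval x (⟨cellsOf fJB, cellsOf fPB, mult, wt⟩ : LinRow).eLo ≤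
      linEval x (⟨cellsOf fJB, cellsOf fPB, mult, wt⟩ : LinRow).eHi := by
    intro mult wt
    change linEval x (cellsOf fJB) ≤ linEval x (cellsOf fPB)
    rw [← measureReal_set_eq_linEval, ← measureReal_set_eq_linEval, set_fJB, set_fPB]; exact hjp
  have hQ7 : linEval x (cellsOf fQ7lo) ≤ linEval x (cellsOf fQ7hi) := by
    rw [← measureReal_set_eq_linEval, ← measureReal_set_eq_linEval, fQ7lo, fQ7hi, set_fQ7, set_fQ7]
    have hjq : (prodBernoulli w).real (openConn (v 2) (v 0)) ≤ (prodBernoulli w).real (openConn (v 4) (v 0)) := hjp.trans hpq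
    exact Q7Psi.q7_three w (v 1) (v 0) (v 3) (v 4) (v 2) (hv.ne (by decide)) (hv.ne (by decide)) (hv.ne (by decide))
      (hv.ne (by decide)) (hv.ne (by decide)) (hv.ne (by decide)) (hv.ne (by decide)) hjp hjq
  have hQ7r : ∀ (mult : List ℕ) (wt : ℕ), linEval x (⟨cellsOf fQ7lo, cellsOf fQ7hi, mult, wt⟩ : LinRow).eLo ≤
      linEval x (⟨cellsOf fQ7lo, cellsOf fQ7hi, mult, wt⟩ : LinRow).eHi := fun _ _ => hQ7
  have hl1 : ∀ r ∈ lrows1, linEval x r.eLo ≤ linEval x r.eHi := by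
    intro r hr
    simp only [lrows1, List.mem_cons, List.mem_nil_iff, or_false] at hr
    rcases hr with rfl | rfl | rfl | rfl | rfl | rfl | rfl | rfl | rfl | rfl | rfl | rfl | rfl
    · exact hJP _ _
    · exact hJP _ _
    · exact hJP _ _
    · exact hJP _ _
    · exact hQ7r _ _
    · exact hQ7r _ _
    · exact hQ7r _ _
    · exact hQ7r _ _
    · exact transportLinRow_holds w v hv 3 4 0 [1] [[(1, 4, true)], [(4, 3, true)]] (by decide) (by decide) (by decide) hpq [512] 1
    · exact transportLinRow_holds w v hv 3 4 0 [1] [[(1, 4, true)]] (by decide) (by decide) (by decide) hpq [514] 2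
    · exact hQ7r _ _
    · exact mixedLinRow_holds w v 3 4 0 [[(4, 1, true)], [(4, 3, true)]] (by decide) hpq [0] 1
    · exact mixedLinRow_holds w v 3 4 0 [[(4, 1, true)]] (by decide) hpq [2] 2
  have key := psiVal_nonneg x hx h1 h2 hl1 hQ7
  simp only [psiVal, x, ← measureReal_set_eq_linEval] at key
  linarith

end LemmaTPsi

end Summit.CriticalPhenomena.PercolationContinuityZ3.Theorems

end
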